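import Mathlib
import Summits.KontsevichZagierPeriods.Zeta5Search.FourthOrderTransport
import Summits.KontsevichZagierPeriods.Zeta5Search.ThirdDigitVProof
import Summits.KontsevichZagierPeriods.Zeta5Search.HarmonicPrimeToPThird
import Summits.KontsevichZagierPeriods.Zeta5Search.HarmonicWolstenholmeCubic
import Summits.KontsevichZagierPeriods.Zeta5Search.SecondResidueLaw
import HarnessLib

/-!
# ζ(5) search — tools for the FOURTH digit of the `V`-row (V4): `λ_p`, the prime-to-`p` harmonic sums in `λ_p`-form,
# the `σ = 1` correction to fourth order, and the class sum of the harmonic corrections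

Cell `pub-zeta5` (HONEST FRAMING: systematic search; no irrationality claim unless certified), gen-2 seat generation 15
(REPORT-gen2-g15 §4; typer g13's L5 work split).  `ThirdDigitVTransport` / `ThirdDigitVProof` (typer g12) one order further.
With `λ_p := H⁽²⁾_{p−1}/(2p)` (`SecondResidueLaw.lambdaP`, a `p`-adic integer by WOLSTENHOLME) and `ℓ = ⌊s/p⌋`, `u = s mod p`:
* `harm_two_pred_eq_lambdaP` (`H⁽²⁾_{p−1} = 2pλ_p`), `padicNorm_lambdaP_le_one`, `padicNorm_harm_pred_add_lambdaP_le`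
  (`H_{p−1} ≡ −p²λ_p (mod p³)`, from gen-2 g14's cubic Wolstenholme congruence `padicNorm_harm_add_half_p_harm2_le_three`);
* `padicNorm_harmN2_sub_lambda_le` — **`N_{s,2} ≡ H⁽²⁾_u − ℓp·2(H⁽³⁾_u − λ_p) (mod p²)`** and `padicNorm_harmN1_sub_lambda_le` —
  **`N_{s,1} ≡ H_u − ℓpH⁽²⁾_u + ℓ²p²(H⁽³⁾_u − λ_p) (mod p³)`** (gen-2 g14's `padicNorm_harmN2_sub_le₂` / `padicNorm_harmN1_sub_le₃` with
  the block terms evaluated by the two congruences above);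
* `corrZero_bound₄` — the `σ = 1` harmonic correction to fourth order: with `c ≡ (−p)^{E+1}ĝ_sX_s (mod p^{E+4})`, `ĝ_sX_s ≡ ĝ_xX
  (mod p³)` (`X = ρ₁ − pφ(ℓρ₁ + ρ₂) + p²c(ℓ²ρ₁ + 2ℓρ₂ + ρ₃)`, third-order transport) and `N ≡ H − ℓpH₂ + ℓ²p²(H₃ − λ) (mod p³)`:
  `cN ≡ (−p)^{E+1}ĝ_x·T₁ (mod p^{E+4})`, `T₁` = the truncation of `X·(H − ℓpH₂ + ℓ²p²(H₃ − λ))` modulo `p³`;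
* `vCorr` — the three harmonic corrections (`σ = 1, 2, 3`) of the `V`-row at fourth order, and `vCorr_classSum` — by the residue
  identities `Σρ₁ = 0`, `Σ(ρ₂ + ℓρ₁) = 0`, `Σ(ρ₃ + 2ℓρ₂ + ℓ²ρ₁) = 0` (`rhoResidueIdentities_holds`, `E ≤ −4`) their class sum is EXACTLY
  `(−p)^{E+1}ĝ_x·p²λ_p·ŵ_x = −(−p)^E ĝ_x·p³λ_pŵ_x`: the `λ_p`-term of `SecondResidueLaw.predV4`.
`p`-adic norms of rational numbers; nothing here concerns irrationality.
-/

noncomputable section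

open Finset

namespace Summit.KontsevichZagierPeriods.Zeta5Search.SecondOrder

open Summit.KontsevichZagierPeriods.Zeta5Search.CasoratianValuation (InPolytope)
open Summit.KontsevichZagierPeriods.Zeta5Search.ClusterValuation
open Summit.KontsevichZagierPeriods.Zeta5Search.PadicSeries
open Summit.KontsevichZagierPeriods.Zeta5Search.CellA (padicNorm_pow_eq padicNorm_p)
open Summit.KontsevichZagierPeriods.Zeta5Search.BigPrime (padicNorm_mul_le_one)
open Summit.KontsevichZagierPeriods.Zeta5Search.SecondResidueLaw (lambdaP)
open Literature.NumberTheory.Transcendental.BallRivoal (harm)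

variable {p : ℕ} [hp : Fact p.Prime]

/-! ### `λ_p = H⁽²⁾_{p−1}/(2p)` -/

/-- `H⁽²⁾_{p−1} = 2p·λ_p`. -/
theorem harm_two_pred_eq_lambdaP : harm 2 (p - 1) = 2 * (p : ℚ) * lambdaP p := by
  have hp0 : (p : ℚ) ≠ 0 := Nat.cast_ne_zero.2 hp.out.ne_zero
  rw [lambdaP]; field_simp

/-- `λ_p` is a `p`-adic integer (`p ≥ 5`; WOLSTENHOLME `H⁽²⁾_{p−1} ≡ 0 (mod p)`). -/
theorem padicNorm_lambdaP_le_one (hp5 : 5 ≤ p) : padicNorm p (lambdaP p) ≤ 1 := by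
  have hp2 : p ≠ 2 := by omega
  have hpos : (0 : ℚ) < (p : ℚ) ^ (-(1 : ℤ)) := zpow_pos (by exact_mod_cast hp.out.pos) _
  rw [lambdaP, padicNorm.div, padicNorm.mul, padicNorm_two hp2, padicNorm_p, one_mul, div_le_one hpos]
  exact padicNorm_harm2_pred_le hp5

/-- `H_{p−1} ≡ −p²λ_p (mod p³)` (`p ≥ 5`): the cubic Wolstenholme congruence in `λ_p`-form. -/
theorem padicNorm_harm_pred_add_lambdaP_le (hp5 : 5 ≤ p) :
    padicNorm p (harm 1 (p - 1) + (p : ℚ) ^ 2 * lambdaP p) ≤ (p : ℚ) ^ (-(3 : ℤ)) := by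
  have hp0 : (p : ℚ) ≠ 0 := Nat.cast_ne_zero.2 hp.out.ne_zero
  have e : (p : ℚ) ^ 2 * lambdaP p = (p : ℚ) / 2 * harm 2 (p - 1) := by rw [lambdaP]; field_simp
  rw [e]; exact padicNorm_harm_add_half_p_harm2_le_three hp5

/-! ### The prime-to-`p` harmonic sums in `λ_p`-form -/

/-- **`N_{s,2} ≡ H⁽²⁾_u − ℓp·2(H⁽³⁾_u − λ_p) (mod p²)`** (`p ≥ 5`; `ℓ = ⌊s/p⌋`, `u = s mod p`). -/
theorem padicNorm_harmN2_sub_lambda_le (hp5 : 5 ≤ p) (s : ℕ) :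
    padicNorm p (harm 2 s - harm 2 (s / p) / (p : ℚ) ^ 2
      - (harm 2 (s % p) - ((s / p : ℕ) : ℚ) * p * (2 * (harm 3 (s % p) - lambdaP p)))) ≤ (p : ℚ) ^ (-(2 : ℤ)) := by
  have h := padicNorm_harmN2_sub_le₂ (p := p) hp5 s
  rw [harm_two_pred_eq_lambdaP] at h
  have e : harm 2 s - harm 2 (s / p) / (p : ℚ) ^ 2 - (harm 2 (s % p) - ((s / p : ℕ) : ℚ) * p * (2 * (harm 3 (s % p) - lambdaP p)))
      = harm 2 s - harm 2 (s / p) / (p : ℚ) ^ 2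
        - (harm 2 (s % p) - 2 * (((s / p : ℕ) : ℚ) * p) * harm 3 (s % p) + ((s / p : ℕ) : ℚ) * (2 * (p : ℚ) * lambdaP p)) := by
    ring
  rw [e]; exact h

/-- **`N_{s,1} ≡ H_u − ℓpH⁽²⁾_u + ℓ²p²(H⁽³⁾_u − λ_p) (mod p³)`** (`p ≥ 5`): the block terms `ℓH_{p−1} − p(ℓ(ℓ−1)/2)H⁽²⁾_{p−1}` of
`padicNorm_harmN1_sub_le₃` equal `−ℓ²p²λ_p` modulo `p³`. -/
theorem padicNorm_harmN1_sub_lambda_le (hp5 : 5 ≤ p) (s : ℕ) :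
    padicNorm p (harm 1 s - harm 1 (s / p) / (p : ℚ) ^ 1
      - (harm 1 (s % p) - ((s / p : ℕ) : ℚ) * p * harm 2 (s % p)
          + ((s / p : ℕ) : ℚ) ^ 2 * (p : ℚ) ^ 2 * (harm 3 (s % p) - lambdaP p))) ≤ (p : ℚ) ^ (-(3 : ℤ)) := by
  have h := padicNorm_harmN1_sub_le₃ (p := p) hp5 s
  rw [harm_two_pred_eq_lambdaP] at h
  have hlam := padicNorm_harm_pred_add_lambdaP_le (p := p) hp5
  have hℓ : padicNorm p ((s / p : ℕ) : ℚ) ≤ 1 := by simpa using padicNorm.of_nat (p := p) (s / p)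
  have e : harm 1 s - harm 1 (s / p) / (p : ℚ) ^ 1
      - (harm 1 (s % p) - ((s / p : ℕ) : ℚ) * p * harm 2 (s % p) + ((s / p : ℕ) : ℚ) ^ 2 * (p : ℚ) ^ 2 * (harm 3 (s % p) - lambdaP p))
      = (harm 1 s - harm 1 (s / p) / (p : ℚ) ^ 1
          - (harm 1 (s % p) - (((s / p : ℕ) : ℚ) * p) * harm 2 (s % p) + (((s / p : ℕ) : ℚ) * p) ^ 2 * harm 3 (s % p)
            + ((s / p : ℕ) : ℚ) * harm 1 (p - 1)
            - (p : ℚ) * (((s / p : ℕ) : ℚ) * (((s / p : ℕ) : ℚ) - 1) / 2) * (2 * (p : ℚ) * lambdaP p)))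
        + ((s / p : ℕ) : ℚ) * (harm 1 (p - 1) + (p : ℚ) ^ 2 * lambdaP p) := by
    ring
  rw [e]
  exact (padicNorm.nonarchimedean (p := p)).trans (max_le h (padicNorm_mul_le_right hℓ hlam))

/-! ### The `σ = 1` harmonic correction to fourth order -/

/-- **`σ = 1` correction to fourth order.**  With `c ≡ (−p)^{E+1}g'X' (mod p^{E+4})`, `g'X' ≡ gX (mod p³)` where
`X = ρ − pφ(ℓρ + ρ') + p²c(ℓ²ρ + 2ℓρ' + ρ'')`, and `N ≡ H − ℓpH₂ + ℓ²p²(H₃ − λ) (mod p³)` (everything `p`-integral):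
`‖cN − (−p)^{E+1}g·T₁‖ ≤ p^{−(E+4)}`, `T₁ = Hρ − pφH(ℓρ + ρ') − pH₂ℓρ + p²(cH(ℓ²ρ + 2ℓρ' + ρ'') + φℓH₂(ℓρ + ρ') + ℓ²(H₃ − λ)ρ)`
(the product `X·(H − ℓpH₂ + ℓ²p²(H₃ − λ))` truncated modulo `p³`). -/
theorem corrZero_bound₄ {c gs Xs g ρ ρ' ρ'' N H H2 H3 lam φ cc ℓ : ℚ} {E : ℤ}
    (hc : padicNorm p (c - (-(p : ℚ)) ^ (E + 1) * gs * Xs) ≤ (p : ℚ) ^ (-(E + 4)))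
    (hΔ : padicNorm p (gs * Xs - g * (ρ - (p : ℚ) * φ * (ℓ * ρ + ρ') + (p : ℚ) ^ 2 * cc * (ℓ ^ 2 * ρ + 2 * ℓ * ρ' + ρ''))) ≤
      (p : ℚ) ^ (-(3 : ℤ)))
    (hN : padicNorm p N ≤ 1)
    (hνN : padicNorm p (N - (H - ℓ * p * H2 + ℓ ^ 2 * (p : ℚ) ^ 2 * (H3 - lam))) ≤ (p : ℚ) ^ (-(3 : ℤ)))
    (hg : padicNorm p g ≤ 1) (hρ : padicNorm p ρ ≤ 1) (hρ' : padicNorm p ρ' ≤ 1) (hρ'' : padicNorm p ρ'' ≤ 1)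
    (hH2 : padicNorm p H2 ≤ 1) (hH3 : padicNorm p H3 ≤ 1) (hlam : padicNorm p lam ≤ 1)
    (hφ : padicNorm p φ ≤ 1) (hcc : padicNorm p cc ≤ 1) (hℓ : padicNorm p ℓ ≤ 1) :
    padicNorm p (c * N - (-(p : ℚ)) ^ (E + 1) * g *
      (H * ρ - (p : ℚ) * φ * H * (ℓ * ρ + ρ') - (p : ℚ) * H2 * ℓ * ρ
        + (p : ℚ) ^ 2 * (cc * H * (ℓ ^ 2 * ρ + 2 * ℓ * ρ' + ρ'') + φ * ℓ * H2 * (ℓ * ρ + ρ') + ℓ ^ 2 * (H3 - lam) * ρ))) ≤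
      (p : ℚ) ^ (-(E + 4)) := by
  have hp0 : (p : ℚ) ≠ 0 := Nat.cast_ne_zero.2 hp.out.ne_zero
  have hp' : (-(p : ℚ)) ≠ 0 := neg_ne_zero.2 hp0
  have hp1 : padicNorm p (p : ℚ) ≤ 1 := padicNorm_p_le_one
  have hpow : padicNorm p ((-(p : ℚ)) ^ (E + 1)) = (p : ℚ) ^ (-(E + 1)) := by
    rw [padicNorm.eq_zpow_of_nonzero (zpow_ne_zero _ hp'), padicValRat.zpow, padicValRat.neg,
      padicValRat.self hp.out.one_lt, mul_one]
  -- the identity: `cN − (−p)^{E+1}gT₁ = (c − (−p)^{E+1}g'X')N + (−p)^{E+1}((g'X' − gX)N + gX(N − Ñ) + g(p³R))`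
  have e : c * N - (-(p : ℚ)) ^ (E + 1) * g *
      (H * ρ - (p : ℚ) * φ * H * (ℓ * ρ + ρ') - (p : ℚ) * H2 * ℓ * ρ
        + (p : ℚ) ^ 2 * (cc * H * (ℓ ^ 2 * ρ + 2 * ℓ * ρ' + ρ'') + φ * ℓ * H2 * (ℓ * ρ + ρ') + ℓ ^ 2 * (H3 - lam) * ρ)) =
      (c - (-(p : ℚ)) ^ (E + 1) * gs * Xs) * N
      + (-(p : ℚ)) ^ (E + 1) *
        ((gs * Xs - g * (ρ - (p : ℚ) * φ * (ℓ * ρ + ρ') + (p : ℚ) ^ 2 * cc * (ℓ ^ 2 * ρ + 2 * ℓ * ρ' + ρ''))) * N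
          + g * (ρ - (p : ℚ) * φ * (ℓ * ρ + ρ') + (p : ℚ) ^ 2 * cc * (ℓ ^ 2 * ρ + 2 * ℓ * ρ' + ρ''))
              * (N - (H - ℓ * p * H2 + ℓ ^ 2 * (p : ℚ) ^ 2 * (H3 - lam)))
          + g * ((p : ℚ) ^ 3 * ((p : ℚ) * (cc * (ℓ ^ 2 * ρ + 2 * ℓ * ρ' + ρ'') * (ℓ ^ 2 * (H3 - lam)))
              - φ * (ℓ * ρ + ρ') * (ℓ ^ 2 * (H3 - lam)) - cc * (ℓ ^ 2 * ρ + 2 * ℓ * ρ' + ρ'') * (ℓ * H2)))) := by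
    ring
  rw [e]
  refine (padicNorm.nonarchimedean (p := p)).trans (max_le (padicNorm_mul_le_left hc hN) ?_)
  rw [padicNorm.mul, hpow]
  -- norms of the pieces
  have hX : padicNorm p (ρ - (p : ℚ) * φ * (ℓ * ρ + ρ') + (p : ℚ) ^ 2 * cc * (ℓ ^ 2 * ρ + 2 * ℓ * ρ' + ρ'')) ≤ 1 :=
    CellA.nI_add (CellA.nI_sub hρ (padicNorm_mul_le_one (padicNorm_mul_le_one hp1 hφ)
      (CellA.nI_add (padicNorm_mul_le_one hℓ hρ) hρ'))) (padicNorm_mul_le_one (padicNorm_mul_le_one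
      (padicNorm_pow_le_one hp1 2) hcc) (CellA.nI_add (CellA.nI_add (padicNorm_mul_le_one
      (padicNorm_pow_le_one hℓ 2) hρ) (padicNorm_mul_le_one (padicNorm_mul_le_one (padicNorm_ofNat_le_one 2) hℓ) hρ')) hρ''))
  have hR : padicNorm p ((p : ℚ) * (cc * (ℓ ^ 2 * ρ + 2 * ℓ * ρ' + ρ'') * (ℓ ^ 2 * (H3 - lam)))
      - φ * (ℓ * ρ + ρ') * (ℓ ^ 2 * (H3 - lam)) - cc * (ℓ ^ 2 * ρ + 2 * ℓ * ρ' + ρ'') * (ℓ * H2)) ≤ 1 :=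
    CellA.nI_sub (CellA.nI_sub (padicNorm_mul_le_one hp1 (padicNorm_mul_le_one (padicNorm_mul_le_one hcc
      (CellA.nI_add (CellA.nI_add (padicNorm_mul_le_one (padicNorm_pow_le_one hℓ 2) hρ) (padicNorm_mul_le_one
      (padicNorm_mul_le_one (padicNorm_ofNat_le_one 2) hℓ) hρ')) hρ'')) (padicNorm_mul_le_one (padicNorm_pow_le_one hℓ 2)
      (CellA.nI_sub hH3 hlam)))) (padicNorm_mul_le_one (padicNorm_mul_le_one hφ (CellA.nI_add
      (padicNorm_mul_le_one hℓ hρ) hρ')) (padicNorm_mul_le_one (padicNorm_pow_le_one hℓ 2) (CellA.nI_sub hH3 hlam))))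
      (padicNorm_mul_le_one (padicNorm_mul_le_one hcc (CellA.nI_add (CellA.nI_add (padicNorm_mul_le_one
      (padicNorm_pow_le_one hℓ 2) hρ) (padicNorm_mul_le_one (padicNorm_mul_le_one (padicNorm_ofNat_le_one 2) hℓ) hρ')) hρ''))
      (padicNorm_mul_le_one hℓ hH2))
  have hR3 : padicNorm p ((p : ℚ) ^ 3 * ((p : ℚ) * (cc * (ℓ ^ 2 * ρ + 2 * ℓ * ρ' + ρ'') * (ℓ ^ 2 * (H3 - lam)))
      - φ * (ℓ * ρ + ρ') * (ℓ ^ 2 * (H3 - lam)) - cc * (ℓ ^ 2 * ρ + 2 * ℓ * ρ' + ρ'') * (ℓ * H2))) ≤ (p : ℚ) ^ (-(3 : ℤ)) := by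
    have h := padicNorm_p_pow_mul_le (p := p) 3 hR
    rwa [mul_one, show ((3 : ℕ) : ℤ) = 3 from rfl] at h
  have hin : padicNorm p
      ((gs * Xs - g * (ρ - (p : ℚ) * φ * (ℓ * ρ + ρ') + (p : ℚ) ^ 2 * cc * (ℓ ^ 2 * ρ + 2 * ℓ * ρ' + ρ''))) * N
        + g * (ρ - (p : ℚ) * φ * (ℓ * ρ + ρ') + (p : ℚ) ^ 2 * cc * (ℓ ^ 2 * ρ + 2 * ℓ * ρ' + ρ''))
            * (N - (H - ℓ * p * H2 + ℓ ^ 2 * (p : ℚ) ^ 2 * (H3 - lam)))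
        + g * ((p : ℚ) ^ 3 * ((p : ℚ) * (cc * (ℓ ^ 2 * ρ + 2 * ℓ * ρ' + ρ'') * (ℓ ^ 2 * (H3 - lam)))
            - φ * (ℓ * ρ + ρ') * (ℓ ^ 2 * (H3 - lam)) - cc * (ℓ ^ 2 * ρ + 2 * ℓ * ρ' + ρ'') * (ℓ * H2)))) ≤ (p : ℚ) ^ (-(3 : ℤ)) :=
    (padicNorm.nonarchimedean (p := p)).trans (max_le ((padicNorm.nonarchimedean (p := p)).trans (max_le
      (padicNorm_mul_le_left hΔ hN) (padicNorm_mul_le_right (padicNorm_mul_le_one hg hX) hνN)))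
      (padicNorm_mul_le_right hg hR3))
  calc (p : ℚ) ^ (-(E + 1)) * _ ≤ (p : ℚ) ^ (-(E + 1)) * (p : ℚ) ^ (-(3 : ℤ)) := mul_le_mul_of_nonneg_left hin (zpow_p_nonneg _)
    _ = (p : ℚ) ^ (-(E + 4)) := by rw [← zpow_add₀ hp0]; ring_nf

/-! ### The harmonic corrections of the `V`-row at fourth order and their class sum -/

/-- The harmonic corrections of the `V`-row at fourth order, at a pole `s` of the class (base data `E, g = ĝ_x, φ = φ_x, cc = c_x,
H = H_x, H2 = H⁽²⁾_x, H3 = H⁽³⁾_x, lam = λ_p`; `ℓ = ⌊s/p⌋`): order `σ = 1` (`o = 0`): `(−p)^{E+1}g·T₁(s)`; `σ = 2` (`o = 1`):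
`(−p)^{E+2}g·(H₂ρ₂ − pφH₂(ℓρ₂ + ρ₃) − p·2(H₃ − λ)·ℓρ₂)`; `σ = 3` (`o = 2`): `(−p)^{E+3}gH₃ρ₃`; zero otherwise. -/
def vCorr (b : ℕ → ℤ) (p : ℕ) (E : ℤ) (g φ cc H H2 H3 lam : ℚ) (s o : ℕ) : ℚ :=
  if o = 0 ∧ netExp b s < 0 then (-(p : ℚ)) ^ (E + 1) * g *
      (H * classRho b p s 1
        - (p : ℚ) * φ * H * (((s / p : ℕ) : ℚ) * classRho b p s 1 + (if netExp b s ≤ -2 then classRho b p s 2 else 0))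
        - (p : ℚ) * H2 * ((s / p : ℕ) : ℚ) * classRho b p s 1
        + (p : ℚ) ^ 2 * (cc * H * (((s / p : ℕ) : ℚ) ^ 2 * classRho b p s 1
              + 2 * ((s / p : ℕ) : ℚ) * (if netExp b s ≤ -2 then classRho b p s 2 else 0)
              + (if netExp b s ≤ -3 then classRho b p s 3 else 0))
            + φ * ((s / p : ℕ) : ℚ) * H2 * (((s / p : ℕ) : ℚ) * classRho b p s 1 + (if netExp b s ≤ -2 then classRho b p s 2 else 0))
            + ((s / p : ℕ) : ℚ) ^ 2 * (H3 - lam) * classRho b p s 1))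
  else if o = 1 ∧ netExp b s < 0 then (-(p : ℚ)) ^ (E + 2) * g *
      (H2 * (if netExp b s ≤ -2 then classRho b p s 2 else 0)
        - (p : ℚ) * φ * H2 * (((s / p : ℕ) : ℚ) * (if netExp b s ≤ -2 then classRho b p s 2 else 0)
            + (if netExp b s ≤ -3 then classRho b p s 3 else 0))
        - (p : ℚ) * (2 * (H3 - lam)) * ((s / p : ℕ) : ℚ) * (if netExp b s ≤ -2 then classRho b p s 2 else 0))
  else if o = 2 ∧ netExp b s < 0 then
      (-(p : ℚ)) ^ (E + 3) * g * H3 * (if netExp b s ≤ -3 then classRho b p s 3 else 0)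
  else 0

/-- Distributing a constant over a four-term class sum. -/
theorem sum_lincomb_four' (s : Finset ℕ) (f₁ f₂ f₃ f₄ : ℕ → ℚ) (K a b c d : ℚ) :
    ∑ i ∈ s, K * (a * f₁ i - b * f₂ i + c * f₃ i + d * f₄ i) =
      K * (a * (∑ i ∈ s, f₁ i) - b * (∑ i ∈ s, f₂ i) + c * (∑ i ∈ s, f₃ i) + d * (∑ i ∈ s, f₄ i)) := by
  classical
  refine Finset.induction_on s (by simp) (fun a s ha ih => ?_)
  rw [sum_insert ha, sum_insert ha, sum_insert ha, sum_insert ha, sum_insert ha, ih]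
  ring

/-- The corrections of one level, summed over the orders, regrouped along the residue identities:
`Σ_o vCorr(s, o) = (−p)^{E+1}g·(H·ρ₁ − p(φH + H₂)·(ρ₂ + ℓρ₁) + p²(cH + φH₂ + H₃ − λ)·(ρ₃ + 2ℓρ₂ + ℓ²ρ₁) + p²λ·ρ₃)` at a pole. -/
theorem vCorr_sum_orders (b : ℕ → ℤ) (E : ℤ) (g φ cc H H2 H3 lam : ℚ) (s : ℕ) :
    ∑ o ∈ range 6, vCorr b p E g φ cc H H2 H3 lam s o =
      if netExp b s < 0 then (-(p : ℚ)) ^ (E + 1) * g *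
        (H * classRho b p s 1
          - (p : ℚ) * (φ * H + H2) * ((if netExp b s ≤ -2 then classRho b p s 2 else 0) + ((s / p : ℕ) : ℚ) * classRho b p s 1)
          + (p : ℚ) ^ 2 * (cc * H + φ * H2 + (H3 - lam)) * ((if netExp b s ≤ -3 then classRho b p s 3 else 0)
              + 2 * ((s / p : ℕ) : ℚ) * (if netExp b s ≤ -2 then classRho b p s 2 else 0)
              + (((s / p : ℕ) : ℚ)) ^ 2 * classRho b p s 1)
          + (p : ℚ) ^ 2 * lam * (if netExp b s ≤ -3 then classRho b p s 3 else 0))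
      else 0 := by
  have hp0 : (p : ℚ) ≠ 0 := Nat.cast_ne_zero.2 hp.out.ne_zero
  have hp' : (-(p : ℚ)) ≠ 0 := neg_ne_zero.2 hp0
  rw [sum_range_succ', sum_range_succ', sum_range_succ']
  have hrest : ∑ o ∈ range 3, vCorr b p E g φ cc H H2 H3 lam s (o + 1 + 1 + 1) = 0 := sum_eq_zero fun o _ => by
    simp only [vCorr, show o + 1 + 1 + 1 ≠ 0 by omega, show o + 1 + 1 + 1 ≠ 1 by omega, show o + 1 + 1 + 1 ≠ 2 by omega,
      false_and, if_false]
  rw [hrest, zero_add, zero_add, one_add_one_eq_two]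
  by_cases hpole : netExp b s < 0
  · simp only [vCorr, hpole, and_true, if_true, (by decide : (1 : ℕ) ≠ 0), (by decide : (2 : ℕ) ≠ 0),
      (by decide : (2 : ℕ) ≠ 1), if_false]
    rw [show E + 2 = E + 1 + 1 by ring, show E + 3 = E + 1 + 1 + 1 by ring, zpow_add_one₀ hp' (E + 1 + 1),
      zpow_add_one₀ hp' (E + 1)]
    ring
  · simp only [vCorr, hpole, and_false, if_false, add_zero]

/-- **Class sum of the harmonic corrections** (`E_x ≤ −4`): by the residue identities the corrections total
`(−p)^{E+1}ĝ_x·p²λ_p·ŵ_x` — the source of the `−p³λ_pŵ_x` term of the fourth `V`-digit. -/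
theorem vCorr_classSum (b : ℕ → ℤ) (hb : InPolytope b) (hp5 : 5 ≤ p) (hwin : (b 0 + 2 : ℤ) < (p : ℤ) ^ 2) {x : ℕ} (hx : x < p)
    (hE4 : classExp b p x ≤ -4) (g φ cc H H2 H3 lam : ℚ) :
    ∑ s ∈ classSet b p x, ∑ o ∈ range 6, vCorr b p (classExp b p x) g φ cc H H2 H3 lam s o =
      (-(p : ℚ)) ^ (classExp b p x + 1) * g * ((p : ℚ) ^ 2 * lam * wHat b p x) := by
  obtain ⟨hS1, hS2, hS3⟩ := rhoResidueIdentities_holds b p x hb hp.out hp5 hwin hx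
  have hres1 := hS1 (by omega)
  have hres2 := hS2 (by omega)
  have hres3 := hS3 (by omega)
  rw [if_neg (by omega)] at hres3
  rw [sum_congr rfl fun s _ => vCorr_sum_orders (p := p) b (classExp b p x) g φ cc H H2 H3 lam s, ← sum_filter]
  change ∑ s ∈ classPoles b p x, _ = _
  rw [sum_lincomb_four', hres1, hres2, hres3, wHat]
  ring

end Summit.KontsevichZagierPeriods.Zeta5Search.SecondOrder

end
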